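import Summits.QuantumFields.YangMills.Theorems.BalabanUVNodesN08AlphaZeroData

/-!
# Route «BalabanUVNodes», Track-A DAG node N08 = [Balaban1985UV3] Thm 1 p. 257 ∕ Thm 2 p. 272 — THE (α) CLAUSE OF THE d = 3 LANE: THE LOAD MAP OF
# THE CLUSTER-EXPANSION DATA SCHEMA AT ZERO EXPANSION DATA (part 2 of 2: THE ROWS) — at the zero data of part 1, `StepDataRows k` IS its residual
# pair, `RunAlpha` IS «residual pairs ∧ the external-input rows», and N08 BY NAME over the zero-data constructed runs asks nothing else

Cell `pub-ymgap`, seat `pub-ymgap-dag-n08-d` gen 6 (director-ym R134 row at the (α) granularity; dag-lead NODE-TABLE v40 «successor on the DATA schema»).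
`bears_on: R4∕N08`; filed `--supports stmt-QuantumFields-20290 --as helper` (K1⁗).  THEOREMS ONLY over part 1 (`…N08AlphaZeroData`) and gen 0's schemas
(`…N08AlphaClassI`); sorry-free, standard axioms.

WHAT THIS FILE PROVES (all at the zero series `zeroRun 𝔊 𝔠`, zero auxiliary data `zeroAlpha 𝔊 𝔠 X hfar`, zero (43)-sizes, ANY external inputs `X`;
hypotheses: `hfar` (G3D-06's right side nonnegative at every step — automatic on the run), `0 ≤ 𝔠.Ca`, `0 ≤ 𝔠.Cc` (the record only carries
`0 ≤ Ca + Cc`; with `Ca < 0` row `h324a` is unsatisfiable by ANY data), and the family condition `g_k ≤ 1` ∕ `g²ε₀ ≤ 1`):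
* §3 `zeroLogZTModel` ∕ `zeroNorm35Model` — G3D-05's and G3D-04's model data EXIST at zero data (no Gaussian variables; `posSemidef_real_of_isEmpty`);
  ★ `stepDataRows_zero_iff`: `StepDataRows 𝔊 𝔠 X (zeroRun 𝔊 𝔠) (zeroAlpha …) k ↔ (∀ h′, Fibre49 … k … h′) ∧ Fibre57Low … k` — the NINETEEN non-residual
  rows hold for zero data (G3D-01 for the zero chart, (28) for `B = 0`, (26) by `rfl`, G3D-06 by sign, `hPY`∕`hPYZ` by `jet26_apply_zero`, G3D-04∕05 by the
  zero models, R-ACT and G3D-02 over the empty graph carrier, (3.24)(a) since `log μ(univ) = 0`, (3.24)(c) since the cgf of the zero potential is constant,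
  `Pint ≡ 0` measurable and `≤ cP = 0`); `oldTermForm_zero` ((43)'s form at zero sizes); `stepRowsI_zero_iff` (the class-I step rows at zero data ARE
  «U_k(·,h) measurable»); ★ `runDataRows_zero_iff`; ★★ `runAlpha_zero_iff`: `RunAlpha 𝔊 𝔠 X (zeroRun 𝔊 𝔠) (zeroAlpha …) ↔ (∀ k < K, residual pair) ∧
  RunRowsI 𝔊 𝔠 X (zeroRun 𝔊 𝔠)` — and `RunRowsI` at zero data reads the external inputs ONLY (`hU`, (67) ∘ large field, (68)).
* §5 ★ `fibre49_zeroRun_iff` ∕ `fibre57Low_zeroRun_iff`: what the residual pair READS at zero data — print's (55)·(58) and the lower step bound with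
  `log Z^{(k)}`, `Σ𝒫_j`, the fluctuation logarithm and the interaction sum all ZERO: the (62) normalisation `(σ₀ g_k^{d(𝔤)})^{|B*|}` alone against the
  minimisers' Boltzmann factors (not decided here for any `X`).
* §4 ★★ `b10_main_zeroRun_upC`: N08 BY NAME (`Dag.B10_main (leavesP w P)`) at the C-binding over the lane's constructed towers of the ZERO series on
  `ScalesLE L ((min γ₀ 1)²)` follows from the residual pairs + the class-I run rows on that family and NOTHING ELSE (gen-0 T4 `…N08Constructed.
  b10_main_constructedLE_upC` at `𝔖 := zeroRun`, `𝔄 := zeroAlpha`).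
READING (the census point, for dag-lead ∕ the chair ∕ the referees' A1–A5): of the (α) clause's displayed DATA rows, the G3D binders «as cited», the
displays (26)∕(28)∕(3.24)(a)(c), the identifications and the regularity rows constrain Bałaban's expansion data only RELATIVE TO EACH OTHER — they are
satisfied by no expansion at all; the clause's quantitative content (what separates the zero tower from print's densities) sits ENTIRELY in the residual
pair R3D-01∕R3D-02 (the one-step fibre inequalities «(49) ≤ (55)·(58)» and the lower bound, pp. 268–272 — whose exponents read the Gaussian values
`log Z^{(k)}`, `log Fl` of (58)∕(63) and the minimisers' actions) and in the class-I rows about print's minimisers (gens 0–5).  So the chair's R434 (c1)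
«non-vacuous instances need `RunDataRows`» sharpens to «… need the RESIDUAL PAIR at non-zero data»; and the lane's own k = 0 theorem
`FibreZeroLane.fibre_pair_zero_piecesW` (SU(2): the pair from print's (12)–(22) data, b11's `hmin`, b9's `hZ`) is exactly where a discharge must start.
HONEST FRAMING: count-neutral kernel statements about the TYPING of the lane's (α) clause; nothing of [B10] asserted; the zero series is test data, not
Bałaban's expansion; N08 NOT discharged; d = 3 lattice gauge theory on finite tori; nothing about d = 4, the continuum, OS axioms, a mass gap or Clay.
-/

noncomputable section

namespace Summit.QuantumFields.YangMills.Theorems.BalabanUVNodesN08AlphaZeroDataRows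

open MeasureTheory ProbabilityTheory Metric
open scoped BigOperators Matrix
open Literature.MathematicalPhysics.QuantumFieldTheory.Balaban1983to89
open Literature.MathematicalPhysics.QuantumFieldTheory.Balaban1983to89.B10
open Literature.MathematicalPhysics.QuantumFieldTheory.Balaban1983to89.B10SectCExpansion (Shape43 Bound44 TermSizes)
open Literature.MathematicalPhysics.QuantumFieldTheory.Balaban1983to89.B10Eq24Cumulant (chiMeasure truncExp)
open Literature.MathematicalPhysics.QuantumFieldTheory.Balaban1983to89.TreeLengthTorus (tsys)
open Literature.MathematicalPhysics.QuantumFieldTheory.Balaban1985CMP102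
open Literature.MathematicalPhysics.QuantumFieldTheory.Balaban1985CMP102.Setting
open Literature.MathematicalPhysics.QuantumFieldTheory.Balaban1985CMP102.Binders
  (ChartAnalyticityAsCited FarTermsDecayAsCited Norm35StepAsCited LogZTExtensiveAsCited LogZTModel GraphRep23AsCited GraphTerms
    LogZLocalizedAsCited)
open Literature.MathematicalPhysics.QuantumFieldTheory.Balaban1985CMP102.BindersNewborn (NewbornTerms45AsCited)
open Summit.QuantumFields.Balaban3D.Carriers
open Summit.QuantumFields.Balaban3D.Proofs.Inputs
open Summit.QuantumFields.Balaban3D.Proofs.Primitives (AlphaConsts)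
open Summit.QuantumFields.Balaban3D.Proofs.GroupModelLieC (lieC)
open Summit.QuantumFields.Balaban3D.Proofs.UVStability3DInputs
open Summit.QuantumFields.Balaban3D.Proofs.Representation33 (jet26 jet26_apply_zero)
open Summit.QuantumFields.Balaban3D.Proofs.Bound55Std (Fibre49 Fibre57Low)
open Summit.QuantumFields.Balaban3D.Proofs.ScalesArithmetic (gk_pos gk_le_one sites_nonneg g0sq_pos)
open Summit.QuantumFields.Balaban3D.Proofs.VacuumAndBooking (rFun_nonneg)
open Summit.QuantumFields.YangMills.Theorems.BalabanUVNodesN08AlphaClassI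
open Summit.QuantumFields.YangMills.Theorems.BalabanUVNodesN08AlphaZeroData

variable {L : ℕ}

/-! ## §3 The rows of the DATA schema at zero data -/

section Rows

variable {S : Scales L} {G : Type} [GaugeGroup G] [MeasurableSpace G] [HaarData G] (𝔊 : GroupModel G) (𝔠 : AlphaConsts L 𝔊.N)
  (X : ExternalInputs S G)

/-- A real matrix over an EMPTY index type is positive semidefinite (it is the zero matrix). [folklore] -/
theorem posSemidef_real_of_isEmpty {ι : Type} [Fintype ι] [DecidableEq ι] [IsEmpty ι] (M : Matrix ι ι ℝ) : M.PosSemidef := by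
  rw [Subsingleton.elim M 0]
  exact Matrix.PosSemidef.zero

/-- **G3D-05's model at zero data**: no Gaussian variables, Jacobian constant `0`; `log Z^{(k)}(T₁^{(k)}, 1) = 0 = 0 + log ∫_{ℝ⁰} 1`.
[cite: Balaban1985UV3, (62) p.271] -/
def zeroLogZTModel (k : ℕ) : LogZTModel (pieces 𝔠.lane X (zeroRun 𝔊 𝔠) k) 𝔠.cT 𝔠.aT 𝔠.cn 𝔠.cJT where
  dim := 0
  Q := 0
  J := 0
  lower := posSemidef_real_of_isEmpty _
  upper := posSemidef_real_of_isEmpty _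
  logZT_eq := by rw [pieces_zeroRun_logZT, gaussLog_of_isEmpty, add_zero]
  count_le := by
    show ((0 : ℕ) : ℝ) ≤ 𝔠.cn * S.sites k
    simpa using mul_nonneg 𝔠.cn_nonneg (sites_nonneg S k)
  jac_le := by
    show |(0 : ℝ)| ≤ 𝔠.cJT * S.sites k
    simpa using mul_nonneg 𝔠.cJT_nonneg (sites_nonneg S k)

/-- **G3D-04's model at zero data**, per history: empty core, no extra coordinates, Jacobian constants `0`. [cite: Balaban1985UV3, (35) p.265] -/
def zeroNorm35Model (k : ℕ) (h : (towerOf 𝔠.lane X (zeroRun 𝔊 𝔠)).Hist (k + 1)) :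
    B10Eq35Norm.Norm35Model (pieces 𝔠.lane X (zeroRun 𝔊 𝔠) k) 𝔠.c35 𝔠.a35 𝔠.cv 𝔠.cJ35 h where
  r := 0
  s := 0
  t := 0
  K := 0
  B₁ := 0
  D₁ := 0
  B₂ := 0
  D₂ := 0
  J₁ := 0
  J₂ := 0
  lower₁ := posSemidef_real_of_isEmpty _
  upper₁ := posSemidef_real_of_isEmpty _
  lower₂ := posSemidef_real_of_isEmpty _
  upper₂ := posSemidef_real_of_isEmpty _
  logZ1_eq := by rw [pieces_zeroRun_logZ1, gaussLog_of_isEmpty, add_zero]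
  logZT_eq := by rw [pieces_zeroRun_logZT, gaussLog_of_isEmpty, add_zero]
  count_le := by
    have := mul_nonneg 𝔠.cv_nonneg ((pieces 𝔠.lane X (zeroRun 𝔊 𝔠) k).Zvol_nonneg h)
    simpa using this
  jac_le := by
    have := mul_nonneg 𝔠.cJ35_nonneg ((pieces 𝔠.lane X (zeroRun 𝔊 𝔠) k).Zvol_nonneg h)
    simpa using this

open Classical in
/-- ★ **THE DATA SCHEMA AT ZERO EXPANSION DATA IS ITS RESIDUAL PAIR.**  For the ZERO step series (every expansion datum `0`, Dirac fluctuation law) with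
the zero auxiliary data and ANY external inputs `X`, at a constants record with `Ca, Cc ≥ 0` and on the family `g_k ≤ 1`: the 21-row schema
`StepDataRows k` HOLDS IFF its two residual rows R3D-01 `fibre49` (every new history) and R3D-02 `fibre57Low` hold — the nineteen other rows (G3D-01∕02∕04∕05∕06
binders, (26), (28), [B1] (3.24)(a)(c), the identifications `hPY`∕`hPYZ`∕`hact`, the measure∕box∕potential regularity, `Pint` measurable and bounded)
are satisfied by zero data.  A statement about the TYPING of the lane's (α) clause (where its quantitative content sits), nothing about [B10].
[cite: Balaban1985UV3, (41) p.266 + (55)–(63) pp.269–272] -/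
theorem stepDataRows_zero_iff
    (hfar : ∀ k, 0 ≤ 𝔠.Cfar * (𝔠.C63 * (S.gk k ^ 7 * (rFun 𝔠.r₀ (S.gk k) * pFun 𝔠.b₀ 𝔠.p₀ (S.gk k)) ^ 7)))
    (hCa : 0 ≤ 𝔠.Ca) (hCc : 0 ≤ 𝔠.Cc) {k : ℕ} (hg1 : S.gk k ≤ 1) :
    StepDataRows 𝔊 𝔠 X (zeroRun 𝔊 𝔠) (zeroAlpha 𝔊 𝔠 X hfar) k ↔
      (∀ h' : Hist S.P (k + 1),
          Fibre49 X 𝔠.lane.carrier (zeroRun 𝔊 𝔠) (fun _ => True) k (piecesW 𝔠.lane X (zeroRun 𝔊 𝔠) k) h') ∧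
        Fibre57Low X 𝔠.lane.carrier (zeroRun 𝔊 𝔠) (fun _ => True) k (piecesW 𝔠.lane X (zeroRun 𝔊 𝔠) k) := by
  refine ⟨fun D => ⟨D.fibre49, D.fibre57Low⟩, fun H => ?_⟩
  have hg : 0 < S.gk k := gk_pos S k
  have hrp := rFun_mul_pFun_nonneg 𝔠 hg1
  exact
    { hμ := by
        show IsProbabilityMeasure (Measure.dirac ())
        infer_instance
      hboxm := fun _ => MeasurableSet.univ
      hbox := fun _ => by
        show (Measure.dirac () : Measure Unit) Set.univ ≠ 0
        simp
      hVm := fun _ _ => aemeasurable_const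
      hVB := fun _ _ _ _ => by
        show |(0 : ℝ)| ≤ 0
        rw [abs_zero]
      chart := fun Y => ⟨𝔠.ρ_pos, differentiableOn_const _, fun z _ => by
        show ‖(0 : ℂ)‖ ≤ _
        rw [norm_zero]
        exact mul_nonneg (mul_nonneg 𝔠.C25_nonneg hg.le) (Real.exp_pos _).le⟩
      bound28 := fun Y h U => by
        show ‖(0 : PBond S.P k → ↥(lieC 𝔊))‖ ≤ _
        rw [norm_zero]
        exact mul_nonneg 𝔠.cB_nonneg (mul_nonneg (mul_nonneg (rFun_nonneg 𝔠.r₀ _ hg hg1) hg.le)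
          (pFun_nonneg 𝔠.b₀ 𝔠.p₀ (S.gk k) 𝔠.b₀_pos.le hg hg1))
      inv26 := fun _ _ _ _ _ => rfl
      far_le := fun Y h U => by
        show |(0 : ℝ)| ≤ _
        rw [abs_zero]
        exact mul_nonneg 𝔠.Cfar_nonneg (mul_nonneg (mul_nonneg (mul_nonneg 𝔠.C25_nonneg hg.le) (Real.exp_pos _).le)
          (mul_nonneg (pow_nonneg hg.le _) (pow_nonneg hrp _)))
      hPY := fun h U => by simp [jet26_apply_zero]
      hPYZ := fun h U => by simp [jet26_apply_zero]
      norm35 := fun h => ⟨zeroNorm35Model 𝔊 𝔠 X k h⟩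
      logZT := ⟨zeroLogZTModel 𝔊 𝔠 X k⟩
      hact := fun h Y U => by
        rw [zeroSeries_act]
        exact zeroGraphTerms_act Y U
      hG := fun h =>
        ⟨fun U => by simp, fun γ hγ => by simp at hγ, fun γ hγ => by simp at hγ, fun γ hγ => by simp at hγ⟩
      h324a := fun h U => by
        show |Real.log ((Measure.dirac () : Measure Unit).real Set.univ)| ≤ _
        rw [probReal_univ, Real.log_one, abs_zero]
        exact mul_nonneg (mul_nonneg hCa (Real.rpow_nonneg (mul_nonneg (pow_nonneg (Nat.cast_nonneg _) _)
          (g0sq_pos S).le) _)) (sites_nonneg S k)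
      h324c := fun h U t _ => by
        rw [cgf_zeroSeries, iteratedDeriv_const, if_neg (Nat.succ_ne_zero _), abs_zero]
        exact mul_nonneg (mul_nonneg (mul_nonneg hCc (Nat.cast_nonneg _)) (Real.rpow_nonneg (mul_nonneg
          (pow_nonneg (Nat.cast_nonneg _) _) (g0sq_pos S).le) _)) (sites_nonneg S k)
      hPm := fun h => by
        have : (inputOf 𝔠.lane X (zeroRun 𝔊 𝔠)).Pint k h = fun _ => 0 := funext (inputOf_zeroRun_Pint 𝔊 𝔠 X k h)
        rw [this]
        exact measurable_const
      hPb := fun h U => by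
        rw [inputOf_zeroRun_Pint]
        exact le_rfl
      fibre49 := H.1
      fibre57Low := H.2 }

/-- **THE (43)-FORM AT ZERO SIZES HOLDS** (no previous-scale terms, all sizes zero): degree floor vacuous, decay and multilinear bounds `0 ≤ 0`.
[cite: Balaban1985UV3, (43) p.266] -/
theorem oldTermForm_zero (k : ℕ) : OldTermForm 𝔊 𝔠 (zeroRun (S := S) 𝔊 𝔠) (zeroSizes S G) k where
  shape43 := fun h U j _ =>
    ⟨fun y n c hP => (hP rfl).elim, fun y n c => by
      show |(0 : ℝ)| ≤ _
      rw [abs_zero]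
      exact mul_nonneg 𝔠.C44_nonneg (Finset.prod_nonneg fun i _ => (Real.exp_pos _).le)⟩
  loop_nonneg := fun _ _ _ _ _ _ => le_rfl
  mult43 := fun h U j _ y n c => by
    show |(0 : ℝ)| ≤ |(0 : ℝ)| * _
    simp

/-- **THE CLASS-I STEP ROWS AT ZERO DATA ARE THE EXTERNAL-INPUT ROW `hU` ALONE**: (44) and the degree floor hold for the absent previous-scale terms;
what remains is «U_k(·, h) measurable» about `X`. [cite: Balaban1985UV3, (44) p.267 + (42) p.266] -/
theorem stepRowsI_zero_iff {k : ℕ} (hg1 : S.gk k ≤ 1) :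
    StepRowsI 𝔊 𝔠 X (zeroRun 𝔊 𝔠) k ↔ ∀ h : Hist S.P k, Measurable (X.UkH k h) := by
  refine ⟨fun I => I.hU, fun hU => ⟨hU, fun h U j _ y n c => ?_, fun h U j _ y n c hne => (hne rfl).elim⟩⟩
  show |(0 : ℝ)| ≤ _
  rw [abs_zero]
  refine mul_nonneg 𝔠.C44_nonneg (Finset.prod_nonneg fun i _ => mul_nonneg (Real.exp_pos _).le (mul_nonneg ?_ ?_))
  · exact mul_nonneg (inv_nonneg.2 (ell_pos S.P k j).le) (oldGeom_dist_nonneg S.P k j _ _)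
  · have hg : 0 < S.gk k := gk_pos S k
    have := pFun_nonneg 𝔠.b₀ 𝔠.p₀ (S.gk k) 𝔠.b₀_pos.le hg hg1
    have hB := 𝔠.B₃_pos
    positivity

/-- ★ **THE RUN'S DATA SCHEMA AT ZERO EXPANSION DATA IS ITS RESIDUAL PAIRS**: on a family member (`g²ε₀ ≤ 1`), `RunDataRows` for the zero series, zero
auxiliary data and zero (43)-sizes HOLDS IFF for every step `k < K` the residual rows R3D-01 (all new histories) and R3D-02 hold.
[cite: Balaban1985UV3, (41) p.266 + (47) p.267 + (55)–(58) pp.269–270] -/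
theorem runDataRows_zero_iff
    (hfar : ∀ k, 0 ≤ 𝔠.Cfar * (𝔠.C63 * (S.gk k ^ 7 * (rFun 𝔠.r₀ (S.gk k) * pFun 𝔠.b₀ 𝔠.p₀ (S.gk k)) ^ 7)))
    (hCa : 0 ≤ 𝔠.Ca) (hCc : 0 ≤ 𝔠.Cc) (hle : S.g ^ 2 * S.ε₀ ≤ 1) :
    RunDataRows 𝔊 𝔠 X (zeroRun 𝔊 𝔠) (zeroAlpha 𝔊 𝔠 X hfar) (zeroSizes S G) ↔
      ∀ k, k + 1 ≤ S.K →
        (∀ h' : Hist S.P (k + 1),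
            Fibre49 X 𝔠.lane.carrier (zeroRun 𝔊 𝔠) (fun _ => True) k (piecesW 𝔠.lane X (zeroRun 𝔊 𝔠) k) h') ∧
          Fibre57Low X 𝔠.lane.carrier (zeroRun 𝔊 𝔠) (fun _ => True) k (piecesW 𝔠.lane X (zeroRun 𝔊 𝔠) k) := by
  refine ⟨fun D k hk => (stepDataRows_zero_iff 𝔊 𝔠 X hfar hCa hCc (gk_le_one S hle k (by omega))).1 (D.steps k hk),
    fun H => ⟨fun k hk => (stepDataRows_zero_iff 𝔊 𝔠 X hfar hCa hCc (gk_le_one S hle k (by omega))).2 (H k hk),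
      fun k _ => oldTermForm_zero 𝔊 𝔠 k⟩⟩

/-- ★ **THE (α) CLAUSE AT ZERO EXPANSION DATA = RESIDUAL PAIRS + THE EXTERNAL-INPUT ROWS**: on a family member, `UVStability3DInputs.RunAlpha` for the zero
series and zero auxiliary data HOLDS IFF (i) for every step `k < K` the residual rows R3D-01∕R3D-02 hold and (ii) the class-I rows of the run hold — which at
zero data read the external inputs `X` only («U_k(·,h) measurable», (67) ∘ large field, (68); `stepRowsI_zero_iff`).  So every quantitative row of [B10]'s
cluster expansion in the lane's (α) clause other than the fibre inequalities is satisfied by NO expansion at all: the clause's content sits in the residual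
pair and in the rows about print's minimisers. [cite: Balaban1985UV3, (41) p.266 + (47) p.267 + (67)–(68) p.273] -/
theorem runAlpha_zero_iff
    (hfar : ∀ k, 0 ≤ 𝔠.Cfar * (𝔠.C63 * (S.gk k ^ 7 * (rFun 𝔠.r₀ (S.gk k) * pFun 𝔠.b₀ 𝔠.p₀ (S.gk k)) ^ 7)))
    (hCa : 0 ≤ 𝔠.Ca) (hCc : 0 ≤ 𝔠.Cc) (hle : S.g ^ 2 * S.ε₀ ≤ 1) :
    RunAlpha 𝔊 𝔠 X (zeroRun 𝔊 𝔠) (zeroAlpha 𝔊 𝔠 X hfar) ↔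
      (∀ k, k + 1 ≤ S.K →
        (∀ h' : Hist S.P (k + 1),
            Fibre49 X 𝔠.lane.carrier (zeroRun 𝔊 𝔠) (fun _ => True) k (piecesW 𝔠.lane X (zeroRun 𝔊 𝔠) k) h') ∧
          Fibre57Low X 𝔠.lane.carrier (zeroRun 𝔊 𝔠) (fun _ => True) k (piecesW 𝔠.lane X (zeroRun 𝔊 𝔠) k)) ∧
      RunRowsI 𝔊 𝔠 X (zeroRun 𝔊 𝔠) := by
  rw [runAlpha_iff]
  refine and_congr_left fun _ => forall_congr' fun k => forall_congr' fun hk => ?_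
  exact stepDataRows_zero_iff 𝔊 𝔠 X hfar hCa hCc (gk_le_one S hle k (by omega))

end Rows

/-! ## §4 N08 BY NAME over the ZERO-DATA constructed runs: what the C-binding closer then asks -/

section N08

open Literature.MathematicalPhysics.QuantumFieldTheory.Balaban1983to89.DagBinding
open Literature.MathematicalPhysics.QuantumFieldTheory.Balaban1983to89.DagDischargedII
open Literature.MathematicalPhysics.QuantumFieldTheory.Balaban1983to89.B10CompactBinding (ofPrintedAllXPNC)
open Summit.QuantumFields.Balaban3D.Proofs.FamilyLE (ScalesLE)
open Summit.QuantumFields.YangMills.Theorems.BalabanUVNodesN08Constructed (b10_main_constructedLE_upC)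

variable {G : Type} [GaugeGroup G] [MeasurableSpace G] [HaarData G] (𝔊 : GroupModel G) (𝔠 : AlphaConsts L 𝔊.N)
  (X : ∀ S : Scales L, ExternalInputs S G)
  {Xc : PrintedCarriersR} {Y : PrintedCarriers9X} {Z : PrintedCarriers11} {V : PrintedCarriers14R} {W : PrintedCarriers15}
  {w : WorldP} {P : B12.RunParams}

/-- ★ **N08 BY NAME AT THE C-BINDING OVER THE ZERO-DATA CONSTRUCTED RUNS ⟸ THE RESIDUAL PAIRS + THE EXTERNAL-INPUT ROWS, NOTHING ELSE**
(gen 0–5's closers read at zero expansion data): if the world's B10 run family is the lane's constructed tower over the ZERO series at every member of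
`ScalesLE L ((min γ₀ 1)²)`, and on that family the residual rows R3D-01∕02 (per step) and the class-I run rows hold for the external inputs `X S`, then
`Dag.B10_main (leavesP w P)`.  The kernel form of the chair's R434 (c1) «non-vacuous instances need `RunDataRows`», SHARPENED: of the displayed (α)
rows only the residual pair and the minimiser rows can tell the zero tower from Bałaban's.  Count-neutral; nothing of [B10] asserted.
[cite: Balaban1985UV3, Thm 1 p.257 (compact reading) + Thm 2 p.272 + (41) p.266] -/
theorem b10_main_zeroRun_upC
    (hfar : ∀ (S : Scales L) (k : ℕ),
      0 ≤ 𝔠.Cfar * (𝔠.C63 * (S.gk k ^ 7 * (rFun 𝔠.r₀ (S.gk k) * pFun 𝔠.b₀ 𝔠.p₀ (S.gk k)) ^ 7)))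
    (hCa : 0 ≤ 𝔠.Ca) (hCc : 0 ≤ 𝔠.Cc)
    (hres : ∀ S : Scales L, S.g ^ 2 * S.ε₀ ≤ (min 𝔠.gamma0 1) ^ 2 → ∀ k, k + 1 ≤ S.K →
      (∀ h' : Hist S.P (k + 1), Fibre49 (X S) 𝔠.lane.carrier (zeroRun 𝔊 𝔠) (fun _ => True) k
          (piecesW 𝔠.lane (X S) (zeroRun 𝔊 𝔠) k) h') ∧
        Fibre57Low (X S) 𝔠.lane.carrier (zeroRun 𝔊 𝔠) (fun _ => True) k (piecesW 𝔠.lane (X S) (zeroRun 𝔊 𝔠) k))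
    (hI : ∀ S : Scales L, S.g ^ 2 * S.ε₀ ≤ (min 𝔠.gamma0 1) ^ 2 → RunRowsI 𝔊 𝔠 (X S) (zeroRun 𝔊 𝔠))
    (hup : w.up P = ofPrintedAllXPNC (Xc.withTowerRuns10 fun S : ScalesLE L ((min 𝔠.gamma0 1) ^ 2) =>
      towerOf 𝔠.lane (X S.1) (zeroRun 𝔊 𝔠)) Y Z V W) :
    Dag.B10_main (leavesP w P) := by
  refine b10_main_constructedLE_upC (𝔄 := fun S => zeroAlpha 𝔊 𝔠 (X S) (hfar S)) (fun S hS => ?_) hup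
  have hle : S.g ^ 2 * S.ε₀ ≤ 1 := hS.trans (by
    have h1 : min 𝔠.gamma0 1 ≤ 1 := min_le_right _ _
    have h0 : 0 ≤ min 𝔠.gamma0 1 := le_min 𝔠.gamma0_pos.le zero_le_one
    nlinarith)
  exact (runAlpha_zero_iff 𝔊 𝔠 (X S) (hfar S) hCa hCc hle).2 ⟨hres S hS, hI S hS⟩

end N08

/-! ## §5 What the residual pair READS at zero data: Bałaban's (55)·(58) and the lower bound with the fluctuation integral DELETED -/

section Residual

open Literature.MathematicalPhysics.QuantumFieldTheory.Balaban1983to89.AveragingRT (rnTransport)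
open Summit.QuantumFields.Balaban3D.Proofs.Bound55Masses (chiB)

variable {S : Scales L} {G : Type} [GaugeGroup G] [MeasurableSpace G] [HaarData G] (𝔊 : GroupModel G) (𝔠 : AlphaConsts L 𝔊.N)
  (X : ExternalInputs S G)

/-- `log Z^{(k)}(B(Λ_{k+1}), U_{k+1})` of the unpinned pieces vanishes at zero data. [folklore] -/
@[simp] theorem piecesW_zeroRun_logZU (k : ℕ) (h : Hist S.P (k + 1)) (U : GaugeField S.P (k + 1) G) :
    (piecesW 𝔠.lane X (zeroRun 𝔊 𝔠) k).logZU h U = 0 :=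
  pieces_zeroRun_logZU 𝔊 𝔠 X k h U

/-- The fluctuation logarithm of the unpinned pieces vanishes at zero data. [folklore] -/
@[simp] theorem piecesW_zeroRun_logFl (k : ℕ) (h : Hist S.P (k + 1)) (U : GaugeField S.P (k + 1) G) :
    (piecesW 𝔠.lane X (zeroRun 𝔊 𝔠) k).logFl h U = 0 :=
  zeroSeries_logFl (S := S) (G := G) (V := ↥(lieC 𝔊)) (N := nblkOf S 𝔠.lane.carrier k) h U

/-- The previous-scale sum «Σ_{j=1}^k Σ_{Y_j} 𝒫_j(Y_j, U_{k+1})» of the unpinned pieces vanishes at zero data. [cite: Balaban1985UV3, (58) p.270] -/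
@[simp] theorem piecesW_zeroRun_Pold (k : ℕ) (h : Hist S.P (k + 1)) (U : GaugeField S.P (k + 1) G) :
    (piecesW 𝔠.lane X (zeroRun 𝔊 𝔠) k).Pold h U = 0 := by
  show (zeroRun 𝔊 𝔠 k).Pold 𝔠.lane.carrier.M₁ (rcolOf S 𝔠.lane.carrier) h U = 0
  rw [StepSeries.Pold, oldSum]
  simp

/-- The interaction sum of the standard tower input vanishes at zero data (`inputOf_zeroRun_Pint` in p1's spelling). [cite: Balaban1985UV3, (43) p.266] -/
@[simp] theorem stdTowerInput_zeroRun_Pint (k : ℕ) (h : Hist S.P k) (U : GaugeField S.P k G) :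
    (stdTowerInput X 𝔠.lane.carrier (zeroRun 𝔊 𝔠)).Pint k h U = 0 :=
  inputOf_zeroRun_Pint 𝔊 𝔠 X k h U

/-- The unpinned pieces carry the record's `log σ₀` (`rfl`). [cite: Balaban1985UV3, (18) p.260] -/
theorem piecesW_zeroRun_logσ₀ (k : ℕ) : (piecesW 𝔠.lane X (zeroRun 𝔊 𝔠) k).logσ₀ = 𝔠.logσ₀ := rfl

/-- The unpinned pieces carry the record's `d(𝔤)` (`rfl`). [cite: Balaban1985UV3, (22) p.261] -/
theorem piecesW_zeroRun_dg (k : ℕ) : (piecesW 𝔠.lane X (zeroRun 𝔊 𝔠) k).dg = (𝔠.dimg : ℝ) := rfl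

/-- The unpinned pieces project histories by `Hist.proj` (`rfl`). [folklore] -/
theorem piecesW_zeroRun_proj (k : ℕ) (h' : Hist S.P (k + 1)) : (piecesW 𝔠.lane X (zeroRun 𝔊 𝔠) k).proj h' = h'.proj := rfl

/-- ★ **R3D-01 AT ZERO DATA, UNFOLDED — (49) ≤ (55)·(58) WITH THE FLUCTUATION INTEGRAL DELETED.**  At the zero series the residual row `Fibre49` of
the new history `h′` READS: the transport over `Ū` of «step weight × small-field factor × mass × exp[−(1∕g_k²)A(U_k) − E_k + Z-terms + R_k]» is
`dV`-a.e. at most the transport of «step weight × mass» times «exp[−(1∕g_{k+1}²)A(U_{k+1}(V)) − E_k + (log σ₀ + d(𝔤) log g_k)·|B(Λ_{k+1}(h′))*| +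
Z-terms + R_k]» — print's (55)·(58) with `log Z^{(k)}`, `Σ𝒫_j` and the fluctuation logarithm of (58) all ZERO: the normalisation `(σ₀ g_k^{d(𝔤)})^{|B*|}`
of (62) stands ALONE against the minimisers' Boltzmann factors.  (For `g_k → 0` and `|B*| ≥ 1` that factor is arbitrarily small — the Gaussian value of the
fluctuation integral is what print's (55)–(58) supply here; this file does not decide the inequality for any `X`.) [cite: Balaban1985UV3, (49)–(58) pp.268–270 + (62) p.271] -/
theorem fibre49_zeroRun_iff (k : ℕ) (h' : Hist S.P (k + 1)) :
    Fibre49 X 𝔠.lane.carrier (zeroRun 𝔊 𝔠) (fun _ => True) k (piecesW 𝔠.lane X (zeroRun 𝔊 𝔠) k) h' ↔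
      (rnTransport (X.av k).avg (fun U =>
          stepWeight 𝔠.lane.carrier.M₁ (rcolOf S 𝔠.lane.carrier) (eps1Of S 𝔠.lane.carrier) (epsSOf S 𝔠.lane.carrier) k h' U *
            chiB 𝔠.lane.carrier.M₁ (rcolOf S 𝔠.lane.carrier) (eps1Of S 𝔠.lane.carrier) k h' U *
            ((stdTowerInput X 𝔠.lane.carrier (zeroRun 𝔊 𝔠)).W.mass k h'.proj U *
              Real.exp (-(((stdTowerInput X 𝔠.lane.carrier (zeroRun 𝔊 𝔠)).towerWith fun _ => True).mainT k h'.proj U) - ((stdTowerInput X 𝔠.lane.carrier (zeroRun 𝔊 𝔠)).towerWith fun _ => True).Ecst k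
                + ((stdTowerInput X 𝔠.lane.carrier (zeroRun 𝔊 𝔠)).towerWith fun _ => True).Zterm k h'.proj + ((stdTowerInput X 𝔠.lane.carrier (zeroRun 𝔊 𝔠)).towerWith fun _ => True).Rm k)))
        ≤ᵐ[fieldMeasure S.P (k + 1) G] fun V =>
          rnTransport (X.av k).avg (fun U =>
              stepWeight 𝔠.lane.carrier.M₁ (rcolOf S 𝔠.lane.carrier) (eps1Of S 𝔠.lane.carrier) (epsSOf S 𝔠.lane.carrier) k h' U *
                (stdTowerInput X 𝔠.lane.carrier (zeroRun 𝔊 𝔠)).W.mass k h'.proj U) V *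
            Real.exp (-(((stdTowerInput X 𝔠.lane.carrier (zeroRun 𝔊 𝔠)).towerWith fun _ => True).mainT (k + 1) h' V) - ((stdTowerInput X 𝔠.lane.carrier (zeroRun 𝔊 𝔠)).towerWith fun _ => True).Ecst k
              + (𝔠.logσ₀ + (𝔠.dimg : ℝ) * Real.log (S.gk k)) * (piecesW 𝔠.lane X (zeroRun 𝔊 𝔠) k).starB h'
              + ((stdTowerInput X 𝔠.lane.carrier (zeroRun 𝔊 𝔠)).towerWith fun _ => True).Zterm k h'.proj + ((stdTowerInput X 𝔠.lane.carrier (zeroRun 𝔊 𝔠)).towerWith fun _ => True).Rm k)) := by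
  unfold Fibre49
  simp only [stdTowerInput_zeroRun_Pint, piecesW_zeroRun_logZU, piecesW_zeroRun_Pold, piecesW_zeroRun_logFl, add_zero,
    piecesW_zeroRun_logσ₀, piecesW_zeroRun_dg, piecesW_zeroRun_proj]

/-- ★ **R3D-02 AT ZERO DATA, UNFOLDED — THE LOWER STEP BOUND WITH THE FLUCTUATION INTEGRAL DELETED**: `χ_{k+1}(V)·exp[−(1∕g_{k+1}²)A(U_{k+1}(V)) − E_k +
(log σ₀ + d(𝔤) log g_k)|T₁^{(k+1)*}| − R_k] ≤ T_k[χ_k·exp(−(1∕g_k²)A(U_k) − E_k − R_k)](V)` a.e. — again the (62) normalisation alone against the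
minimisers' Boltzmann factors. [cite: Balaban1985UV3, p.265 L21–28 + (47) p.267 + p.272 L32–33] -/
theorem fibre57Low_zeroRun_iff (k : ℕ) :
    Fibre57Low X 𝔠.lane.carrier (zeroRun 𝔊 𝔠) (fun _ => True) k (piecesW 𝔠.lane X (zeroRun 𝔊 𝔠) k) ↔
      ((fun V => ((stdTowerInput X 𝔠.lane.carrier (zeroRun 𝔊 𝔠)).towerWith fun _ => True).chi (k + 1) V *
          Real.exp (-(((stdTowerInput X 𝔠.lane.carrier (zeroRun 𝔊 𝔠)).towerWith fun _ => True).mainT (k + 1) (Hist.triv S.P (k + 1)) V)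
            - ((stdTowerInput X 𝔠.lane.carrier (zeroRun 𝔊 𝔠)).towerWith fun _ => True).Ecst k
            + (𝔠.logσ₀ + (𝔠.dimg : ℝ) * Real.log (S.gk k)) * (piecesW 𝔠.lane X (zeroRun 𝔊 𝔠) k).starB (Hist.triv S.P (k + 1))
            - ((stdTowerInput X 𝔠.lane.carrier (zeroRun 𝔊 𝔠)).towerWith fun _ => True).Rm k))
        ≤ᵐ[fieldMeasure S.P (k + 1) G] rnTransport (X.av k).avg (fun U => ((stdTowerInput X 𝔠.lane.carrier (zeroRun 𝔊 𝔠)).towerWith fun _ => True).chi k U *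
          Real.exp (-(((stdTowerInput X 𝔠.lane.carrier (zeroRun 𝔊 𝔠)).towerWith fun _ => True).mainT k (Hist.triv S.P k) U)
            - ((stdTowerInput X 𝔠.lane.carrier (zeroRun 𝔊 𝔠)).towerWith fun _ => True).Ecst k - ((stdTowerInput X 𝔠.lane.carrier (zeroRun 𝔊 𝔠)).towerWith fun _ => True).Rm k))) := by
  unfold Fibre57Low
  simp only [stdTowerInput_zeroRun_Pint, piecesW_zeroRun_logZU, piecesW_zeroRun_Pold, piecesW_zeroRun_logFl, add_zero,
    piecesW_zeroRun_logσ₀, piecesW_zeroRun_dg]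

end Residual

end Summit.QuantumFields.YangMills.Theorems.BalabanUVNodesN08AlphaZeroDataRows

end
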